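import Mathlib
import HarnessLib
import Summits.RiemannHypothesis.RiemannHypothesis.Theorems.DbrWallAntipersistence

/-!
# DBR column, rung B-P(P1): anti-persistence THROUGH THE FIRST PRIME — identity and concavity on
# `[(log 2)/2, (log 3)/2]`

RH-FREE calculus facts (LINE 1 of the label discipline): identities and concavity properties of the explicit
archimedean–Lerch closed form of Suzuki2023 (1.1) and of its first prime term `Λ(2) 2^{−1/2}(t − log 2)₊`;
NOT worded as, and not, progress toward RH.

Companion of `DbrWallAntipersistence` (p440661: `Ψ(2s) < 2Ψ(s)` on the prime-free wall `0 < s ≤ (log 2)/2`).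
Beyond the wall, for `log 2 ≤ 2s ≤ log 3`, exactly one prime power enters `Ψ(2s)` and `Ψ(s)` is still
prime-free, so (`two_mul_zetaScrew_sub_eq_gap_add_prime`)
`2Ψ(s) − Ψ(2s) = D(s) + (log 2/√2)(2s − log 2)`, `D(s) = Σ_{k≥0}(1 − e^{−λ'_k s})²/λ'_k² − 4(e^{s/2} − 1)²`,
`λ'_k = 2k + 5/2`. On `s ≥ (log 2)/2` every `λ'_k s ≥ log 2`, where `u ↦ (1 − e^{−u})²` is CONCAVE
(`concaveOn_sq_one_sub_exp_neg`), and `s ↦ −4(e^{s/2} − 1)²` is concave on `s ≥ 0`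
(`concaveOn_neg_four_mul_sq_exp_half_sub_one`); hence the two-point gap is concave there
(`gapSeries_concave`, `gap_add_prime_concave`: the convex-combination inequality between any two meshes
`x, y ≥ (log 2)/2`). The assembly (`Ψ(2s) < 2Ψ(s)` for all `0 < s ≤ (log 3)/2`) is the companion file
`DbrWallAntipersistencePrime`, which adds the one rational certificate at `s₁ = (log 3)/2`.

Method [folklore]: `zetaScrewPrimeSum_eq_sum_max` with cut-off `3` (`Λ(1) = 0`, `Λ(2) = log 2`, the `n = 3`
term carries the factor `(t − log 3)₊ = 0`); the closed-form algebra of p440661 (`two_mul_closedForm_sub`);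
concavity from antitone derivatives (`AntitoneOn.concaveOn_of_deriv`). References: M. Suzuki, J. Lond. Math.
Soc. (2) 108 (2023) = arXiv:2206.03682, (1.1) [Suzuki2023]. Nothing here bears on the truth of RH. -/

set_option linter.dupNamespace false

noncomputable section

open scoped BigOperators
open Set
namespace Summit.RiemannHypothesis.RiemannHypothesis.Theorems.DbrWall

open Literature.NumberTheory.LFunctions

/-! ### `Ψ` with exactly one prime: `log 2 ≤ t ≤ log 3` -/

/-- For `log 2 ≤ t ≤ log 3` the prime sum of (1.1) is the single term `(log 2/√2)(t − log 2)`. [cite: Suzuki2023, (1.1)] -/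
theorem zetaScrewPrimeSum_eq_of_log_two_le {t : ℝ} (h2 : Real.log 2 ≤ t) (h3 : t ≤ Real.log 3) :
    zetaScrewPrimeSum t = Real.log 2 / Real.sqrt 2 * (t - Real.log 2) := by
  have ht0 : 0 < t := lt_of_lt_of_le (Real.log_pos one_lt_two) h2
  have hM : Real.exp |t| ≤ ((3 : ℕ) : ℝ) := by
    rw [abs_of_pos ht0]
    calc Real.exp t ≤ Real.exp (Real.log 3) := Real.exp_le_exp.2 h3
      _ = 3 := Real.exp_log (by norm_num)
      _ = ((3 : ℕ) : ℝ) := by norm_num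
  rw [zetaScrewPrimeSum_eq_sum_max hM, abs_of_pos ht0,
    show Finset.Icc (1 : ℕ) 3 = {1, 2, 3} from by decide,
    Finset.sum_insert (by decide), Finset.sum_insert (by decide), Finset.sum_singleton]
  have h1 : ArithmeticFunction.vonMangoldt 1 = 0 := ArithmeticFunction.vonMangoldt_apply_one
  have hΛ2 : ArithmeticFunction.vonMangoldt 2 = Real.log 2 := by
    rw [ArithmeticFunction.vonMangoldt_apply_prime Nat.prime_two]; norm_num
  have hm2 : max (t - Real.log ((2 : ℕ) : ℝ)) 0 = t - Real.log 2 := by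
    push_cast; exact max_eq_left (by linarith)
  have hm3 : max (t - Real.log ((3 : ℕ) : ℝ)) 0 = 0 := by
    push_cast; exact max_eq_right (by linarith)
  rw [h1, hΛ2, hm2, hm3]
  push_cast
  ring

/-- (1.1) with its first prime: for `log 2 ≤ t ≤ log 3`,
`Ψ(t) = 8(cosh(t/2) − 1) − (A/2)t + Σ_k (1 − e^{−λ_k t})/λ_k² − (log 2/√2)(t − log 2)`, `λ_k = 2k + ½`.
[cite: Suzuki2023, (1.1)] -/
theorem zetaScrew_eq_cosh_tsum_sub_prime {t : ℝ} (h2 : Real.log 2 ≤ t) (h3 : t ≤ Real.log 3) :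
    zetaScrew t = 8 * (Real.cosh (t / 2) - 1)
      - (Real.eulerMascheroniConstant + Real.pi / 2 + 3 * Real.log 2 + Real.log Real.pi) / 2 * t
      + (∑' k : ℕ, (1 - Real.exp (-((2 * k + 1 / 2) * t))) / (2 * (k : ℝ) + 1 / 2) ^ 2)
      - Real.log 2 / Real.sqrt 2 * (t - Real.log 2) := by
  have ht0 : 0 ≤ t := le_trans (Real.log_nonneg one_le_two) h2
  have key : zetaScrew t = 8 * (Real.cosh (t / 2) - 1)
      - (Real.eulerMascheroniConstant + Real.pi / 2 + 3 * Real.log 2 + Real.log Real.pi) / 2 * |t|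
      + (∑' k : ℕ, (1 - Real.exp (-((2 * k + 1 / 2) * |t|))) / (2 * (k : ℝ) + 1 / 2) ^ 2)
      - Real.log 2 / Real.sqrt 2 * (t - Real.log 2) := by
    rw [zetaScrew_eq, zetaScrewPrimeSum_eq_of_log_two_le h2 h3, hurwitzLerchQuarter]
    have hcosh : Real.exp (|t| / 2) + Real.exp (-(|t| / 2)) - 2 = 2 * (Real.cosh (t / 2) - 1) := by
      rw [← Real.cosh_abs (t / 2), Real.cosh_eq, abs_div, abs_two]
      ring
    rw [hcosh, ← tsum_mul_left, ← (summable_one_div_nat_add_quarter_sq).tsum_sub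
      ((summable_hurwitzLerchQuarter t).mul_left _), ← tsum_mul_left]
    have hterm : ∀ k : ℕ, (1 / 4 : ℝ) * (1 / ((k : ℝ) + 1 / 4) ^ 2
        - Real.exp (-(|t| / 2)) * (Real.exp (-(2 * |t| * k)) / ((k : ℝ) + 1 / 4) ^ 2))
        = (1 - Real.exp (-((2 * k + 1 / 2) * |t|))) / (2 * (k : ℝ) + 1 / 2) ^ 2 := by
      intro k
      have hk : (2 * (k : ℝ) + 1 / 2) ^ 2 = 4 * ((k : ℝ) + 1 / 4) ^ 2 := by ring
      have hk0 : ((k : ℝ) + 1 / 4) ^ 2 ≠ 0 := by positivity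
      rw [hk, show Real.exp (-((2 * k + 1 / 2) * |t|))
          = Real.exp (-(|t| / 2)) * Real.exp (-(2 * |t| * k)) by rw [← Real.exp_add]; ring_nf]
      field_simp
    rw [tsum_congr hterm]
    ring
  rwa [abs_of_nonneg ht0] at key

/-! ### The closed-form algebra (as in p440661) and the identity beyond the wall -/

/-- The closed-form two-point algebra: with `CF(t) = 8(cosh(t/2)−1) − (A/2)t + Σ_k(1 − e^{−λ_k t})/λ_k²`,
`2·CF(s) − CF(2s) = Σ_{k≥0}(1 − e^{−λ'_k s})²/λ'_k² − 4(e^{s/2} − 1)²` for every `s ≥ 0` (linear term and the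
`k = 0` Lerch term cancel). [folklore] -/
theorem two_mul_closedForm_sub {s : ℝ} (hs0 : 0 ≤ s) :
    2 * (8 * (Real.cosh (s / 2) - 1)
        - (Real.eulerMascheroniConstant + Real.pi / 2 + 3 * Real.log 2 + Real.log Real.pi) / 2 * s
        + ∑' k : ℕ, (1 - Real.exp (-((2 * k + 1 / 2) * s))) / (2 * (k : ℝ) + 1 / 2) ^ 2)
      - (8 * (Real.cosh (2 * s / 2) - 1)
        - (Real.eulerMascheroniConstant + Real.pi / 2 + 3 * Real.log 2 + Real.log Real.pi) / 2 * (2 * s)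
        + ∑' k : ℕ, (1 - Real.exp (-((2 * k + 1 / 2) * (2 * s)))) / (2 * (k : ℝ) + 1 / 2) ^ 2)
      = (∑' k : ℕ, (1 - Real.exp (-((2 * (k : ℝ) + 5 / 2) * s))) ^ 2 / (2 * (k : ℝ) + 5 / 2) ^ 2)
        - 4 * (Real.exp (s / 2) - 1) ^ 2 := by
  set a : ℝ := Real.exp (s / 2) with ha
  have ha0 : 0 < a := Real.exp_pos _
  have hcosh1 : Real.cosh (s / 2) = (a + a⁻¹) / 2 := by
    rw [Real.cosh_eq, Real.exp_neg]
  have hcosh2 : Real.cosh (2 * s / 2) = (a * a + a⁻¹ * a⁻¹) / 2 := by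
    rw [show 2 * s / 2 = s / 2 + s / 2 by ring, Real.cosh_eq, neg_add, Real.exp_add, Real.exp_add,
      Real.exp_neg]
  have hS1 := summable_wall_terms hs0
  have hS2 := summable_wall_terms (by linarith : (0 : ℝ) ≤ 2 * s)
  have hsq : ∀ k : ℕ, 2 * ((1 - Real.exp (-((2 * k + 1 / 2) * s))) / (2 * (k : ℝ) + 1 / 2) ^ 2)
      - (1 - Real.exp (-((2 * k + 1 / 2) * (2 * s)))) / (2 * (k : ℝ) + 1 / 2) ^ 2
      = (1 - Real.exp (-((2 * k + 1 / 2) * s))) ^ 2 / (2 * (k : ℝ) + 1 / 2) ^ 2 := by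
    intro k
    have he : Real.exp (-((2 * k + 1 / 2) * (2 * s))) = Real.exp (-((2 * k + 1 / 2) * s)) ^ 2 := by
      rw [sq, ← Real.exp_add]; ring_nf
    rw [he]
    have h0 : (2 * (k : ℝ) + 1 / 2) ^ 2 ≠ 0 := by positivity
    field_simp
    ring
  have hT : 2 * (∑' k : ℕ, (1 - Real.exp (-((2 * k + 1 / 2) * s))) / (2 * (k : ℝ) + 1 / 2) ^ 2)
      - (∑' k : ℕ, (1 - Real.exp (-((2 * k + 1 / 2) * (2 * s)))) / (2 * (k : ℝ) + 1 / 2) ^ 2)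
      = ∑' k : ℕ, (1 - Real.exp (-((2 * k + 1 / 2) * s))) ^ 2 / (2 * (k : ℝ) + 1 / 2) ^ 2 := by
    rw [← tsum_mul_left, ← (hS1.mul_left 2).tsum_sub hS2]
    exact tsum_congr hsq
  have hS3 : Summable fun k : ℕ =>
      (1 - Real.exp (-((2 * k + 1 / 2) * s))) ^ 2 / (2 * (k : ℝ) + 1 / 2) ^ 2 := by
    have := (hS1.mul_left 2).sub hS2
    refine this.congr fun k => ?_
    rw [← hsq k]
  have hsplit := hS3.tsum_eq_zero_add
  have hshift : ∀ k : ℕ, (1 - Real.exp (-((2 * ((k + 1 : ℕ) : ℝ) + 1 / 2) * s))) ^ 2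
      / (2 * ((k + 1 : ℕ) : ℝ) + 1 / 2) ^ 2
      = (1 - Real.exp (-((2 * (k : ℝ) + 5 / 2) * s))) ^ 2 / (2 * (k : ℝ) + 5 / 2) ^ 2 := by
    intro k
    have : (2 * ((k + 1 : ℕ) : ℝ) + 1 / 2) = (2 * (k : ℝ) + 5 / 2) := by push_cast; ring
    rw [this]
  simp only [hshift, Nat.cast_zero, mul_zero, zero_add] at hsplit
  have h0 : (1 - Real.exp (-(1 / 2 * s))) ^ 2 / (1 / 2 : ℝ) ^ 2 = 4 * (1 - a⁻¹) ^ 2 := by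
    rw [show -(1 / 2 * s) = -(s / 2) by ring, Real.exp_neg]
    ring
  rw [h0] at hsplit
  rw [hcosh1, hcosh2]
  linear_combination hT + hsplit

/-- **Two-point identity through the first prime**: for `log 2 ≤ 2s ≤ log 3`,
`2Ψ(s) − Ψ(2s) = Σ_{k≥0}(1 − e^{−λ'_k s})²/λ'_k² − 4(e^{s/2} − 1)² + (log 2/√2)(2s − log 2)`. [folklore] -/
theorem two_mul_zetaScrew_sub_eq_gap_add_prime {s : ℝ} (h2 : Real.log 2 ≤ 2 * s)
    (h3 : 2 * s ≤ Real.log 3) :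
    2 * zetaScrew s - zetaScrew (2 * s) =
      (∑' k : ℕ, (1 - Real.exp (-((2 * (k : ℝ) + 5 / 2) * s))) ^ 2 / (2 * (k : ℝ) + 5 / 2) ^ 2)
      - 4 * (Real.exp (s / 2) - 1) ^ 2 + Real.log 2 / Real.sqrt 2 * (2 * s - Real.log 2) := by
  have hl2 : 0 < Real.log 2 := Real.log_pos one_lt_two
  have hs0 : 0 ≤ s := by linarith
  -- `log 3 < log 4 = 2 log 2` (also in the tree as `SemilocalDeletionDipoleHalfRoom.log_three_lt_two_mul_log_two`)
  have h34 : Real.log 3 < 2 * Real.log 2 := by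
    have h : Real.log 3 < Real.log 4 := Real.log_lt_log (by norm_num) (by norm_num)
    have h4 : Real.log 4 = 2 * Real.log 2 := by
      rw [show (4 : ℝ) = 2 ^ 2 by norm_num, Real.log_pow]; norm_num
    linarith
  have hs1 : s ≤ Real.log 2 := by linarith
  rw [zetaScrew_eq_cosh_tsum_of_le hs0 hs1, zetaScrew_eq_cosh_tsum_sub_prime h2 h3]
  have h := two_mul_closedForm_sub hs0
  linear_combination h

/-! ### Concavity -/

/-- `u ↦ (1 − e^{−u})²` is concave on `[log 2, ∞)` (its derivative `2e^{−u}(1 − e^{−u})` decreases once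
`e^{−u} ≤ ½`). [folklore] -/
theorem concaveOn_sq_one_sub_exp_neg :
    ConcaveOn ℝ (Ici (Real.log 2)) (fun u : ℝ => (1 - Real.exp (-u)) ^ 2) := by
  have hd : ∀ u : ℝ, HasDerivAt (fun u : ℝ => (1 - Real.exp (-u)) ^ 2)
      (2 * (1 - Real.exp (-u)) * Real.exp (-u)) u := by
    intro u
    have h1 : HasDerivAt (fun u : ℝ => 1 - Real.exp (-u)) (Real.exp (-u)) u := by
      have := ((hasDerivAt_id u).neg.exp).const_sub 1
      simpa using this
    have hf : (fun u : ℝ => (1 - Real.exp (-u)) ^ 2)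
        = fun u : ℝ => (1 - Real.exp (-u)) * (1 - Real.exp (-u)) := by
      ext; ring
    rw [hf]
    exact (h1.fun_mul h1).congr_deriv (by ring)
  refine AntitoneOn.concaveOn_of_deriv (convex_Ici _) ?_ ?_ ?_
  · exact (fun u _ => (hd u).continuousAt.continuousWithinAt)
  · exact fun u _ => (hd u).differentiableAt.differentiableWithinAt
  · rw [interior_Ici]
    intro u hu v hv huv
    rw [(hd u).deriv, (hd v).deriv]
    have hu2 : Real.exp (-u) < 1 / 2 := by
      have h12 : Real.exp (-Real.log 2) = 1 / 2 := by
        rw [Real.exp_neg, Real.exp_log two_pos, one_div]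
      have : Real.exp (-u) < Real.exp (-Real.log 2) := Real.exp_lt_exp.2 (by linarith [hu.out])
      rwa [h12] at this
    have hvu : Real.exp (-v) ≤ Real.exp (-u) := Real.exp_le_exp.2 (by linarith)
    have hv0 : 0 < Real.exp (-v) := Real.exp_pos _
    nlinarith [mul_nonneg (sub_nonneg.2 hvu) (by linarith : (0:ℝ) ≤ 1 - Real.exp (-u) - Real.exp (-v))]

/-- `s ↦ −4(e^{s/2} − 1)²` is concave on `[0, ∞)` (its derivative `−4(e^{s/2} − 1)e^{s/2}` decreases).
[folklore] -/
theorem concaveOn_neg_four_mul_sq_exp_half_sub_one :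
    ConcaveOn ℝ (Ici (0 : ℝ)) (fun s : ℝ => -(4 * (Real.exp (s / 2) - 1) ^ 2)) := by
  have hd : ∀ s : ℝ, HasDerivAt (fun s : ℝ => -(4 * (Real.exp (s / 2) - 1) ^ 2))
      (-(4 * (Real.exp (s / 2) - 1) * Real.exp (s / 2))) s := by
    intro s
    have h1 : HasDerivAt (fun s : ℝ => Real.exp (s / 2) - 1) (Real.exp (s / 2) * (1 / 2)) s := by
      have := ((hasDerivAt_id s).div_const 2).exp.sub_const 1
      simpa using this
    have hf : (fun s : ℝ => -(4 * (Real.exp (s / 2) - 1) ^ 2))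
        = fun s : ℝ => -4 * ((Real.exp (s / 2) - 1) * (Real.exp (s / 2) - 1)) := by
      ext; ring
    rw [hf]
    exact ((h1.fun_mul h1).const_mul (-4)).congr_deriv (by ring)
  refine AntitoneOn.concaveOn_of_deriv (convex_Ici _) ?_ ?_ ?_
  · exact (fun s _ => (hd s).continuousAt.continuousWithinAt)
  · exact fun s _ => (hd s).differentiableAt.differentiableWithinAt
  · rw [interior_Ici]
    intro u hu v hv huv
    rw [(hd u).deriv, (hd v).deriv]
    have hu1 : 1 ≤ Real.exp (u / 2) := Real.one_le_exp (by linarith [hu.out])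
    have hvu : Real.exp (u / 2) ≤ Real.exp (v / 2) := Real.exp_le_exp.2 (by linarith)
    nlinarith [mul_nonneg (sub_nonneg.2 hvu) (by linarith : (0:ℝ) ≤ Real.exp (u / 2) + Real.exp (v / 2) - 1)]

/-- **Concavity of the gap series** on meshes `≥ (log 2)/2` (there `λ'_k s ≥ (5/4) log 2 ≥ log 2` for all `k`):
for `x, y ≥ (log 2)/2`, `a, b ≥ 0`, `a + b = 1`,
`a·Σ_k(1−e^{−λ'_k x})²/λ'_k² + b·Σ_k(1−e^{−λ'_k y})²/λ'_k² ≤ Σ_k(1−e^{−λ'_k(ax+by)})²/λ'_k²`. [folklore] -/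
theorem gapSeries_concave {x y a b : ℝ} (hx : Real.log 2 / 2 ≤ x) (hy : Real.log 2 / 2 ≤ y)
    (ha : 0 ≤ a) (hb : 0 ≤ b) (hab : a + b = 1) :
    a * (∑' k : ℕ, (1 - Real.exp (-((2 * (k : ℝ) + 5 / 2) * x))) ^ 2 / (2 * (k : ℝ) + 5 / 2) ^ 2)
      + b * (∑' k : ℕ, (1 - Real.exp (-((2 * (k : ℝ) + 5 / 2) * y))) ^ 2 / (2 * (k : ℝ) + 5 / 2) ^ 2)
      ≤ ∑' k : ℕ, (1 - Real.exp (-((2 * (k : ℝ) + 5 / 2) * (a * x + b * y)))) ^ 2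
          / (2 * (k : ℝ) + 5 / 2) ^ 2 := by
  have hl2 : 0 < Real.log 2 := Real.log_pos one_lt_two
  have hx0 : 0 ≤ x := by linarith
  have hy0 : 0 ≤ y := by linarith
  have hz0 : 0 ≤ a * x + b * y := by positivity
  have hSx := summable_gap_terms hx0
  have hSy := summable_gap_terms hy0
  have hSz := summable_gap_terms hz0
  rw [← tsum_mul_left, ← tsum_mul_left, ← (hSx.mul_left a).tsum_add (hSy.mul_left b)]
  refine ((hSx.mul_left a).add (hSy.mul_left b)).tsum_le_tsum (fun k => ?_) hSz
  have hl : (0 : ℝ) < 2 * (k : ℝ) + 5 / 2 := by positivity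
  have hl1 : (5 / 2 : ℝ) ≤ 2 * (k : ℝ) + 5 / 2 := by
    have : (0 : ℝ) ≤ k := Nat.cast_nonneg k
    linarith
  have hmx : (2 * (k : ℝ) + 5 / 2) * x ∈ Ici (Real.log 2) := by
    show Real.log 2 ≤ (2 * (k : ℝ) + 5 / 2) * x
    nlinarith
  have hmy : (2 * (k : ℝ) + 5 / 2) * y ∈ Ici (Real.log 2) := by
    show Real.log 2 ≤ (2 * (k : ℝ) + 5 / 2) * y
    nlinarith
  have hc := concaveOn_sq_one_sub_exp_neg.2 hmx hmy ha hb hab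
  simp only [smul_eq_mul] at hc
  rw [show a * ((2 * (k : ℝ) + 5 / 2) * x) + b * ((2 * (k : ℝ) + 5 / 2) * y)
      = (2 * (k : ℝ) + 5 / 2) * (a * x + b * y) by ring] at hc
  have hc' := div_le_div_of_nonneg_right hc (le_of_lt (pow_pos hl 2))
  have e : a * ((1 - Real.exp (-((2 * (k : ℝ) + 5 / 2) * x))) ^ 2 / (2 * (k : ℝ) + 5 / 2) ^ 2)
      + b * ((1 - Real.exp (-((2 * (k : ℝ) + 5 / 2) * y))) ^ 2 / (2 * (k : ℝ) + 5 / 2) ^ 2)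
      = (a * (1 - Real.exp (-((2 * (k : ℝ) + 5 / 2) * x))) ^ 2
        + b * (1 - Real.exp (-((2 * (k : ℝ) + 5 / 2) * y))) ^ 2) / (2 * (k : ℝ) + 5 / 2) ^ 2 := by
    ring
  rw [e]
  exact hc'

/-- **Concavity of the two-point gap through the first prime**: for `x, y ≥ (log 2)/2`, `a, b ≥ 0`, `a + b = 1`,
the function `F(s) = Σ_k(1−e^{−λ'_k s})²/λ'_k² − 4(e^{s/2}−1)² + (log 2/√2)(2s − log 2)` satisfies
`a·F(x) + b·F(y) ≤ F(ax + by)`. [folklore] -/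
theorem gap_add_prime_concave {x y a b : ℝ} (hx : Real.log 2 / 2 ≤ x) (hy : Real.log 2 / 2 ≤ y)
    (ha : 0 ≤ a) (hb : 0 ≤ b) (hab : a + b = 1) :
    a * ((∑' k : ℕ, (1 - Real.exp (-((2 * (k : ℝ) + 5 / 2) * x))) ^ 2 / (2 * (k : ℝ) + 5 / 2) ^ 2)
          - 4 * (Real.exp (x / 2) - 1) ^ 2 + Real.log 2 / Real.sqrt 2 * (2 * x - Real.log 2))
      + b * ((∑' k : ℕ, (1 - Real.exp (-((2 * (k : ℝ) + 5 / 2) * y))) ^ 2 / (2 * (k : ℝ) + 5 / 2) ^ 2)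
          - 4 * (Real.exp (y / 2) - 1) ^ 2 + Real.log 2 / Real.sqrt 2 * (2 * y - Real.log 2))
      ≤ (∑' k : ℕ, (1 - Real.exp (-((2 * (k : ℝ) + 5 / 2) * (a * x + b * y)))) ^ 2
            / (2 * (k : ℝ) + 5 / 2) ^ 2)
          - 4 * (Real.exp ((a * x + b * y) / 2) - 1) ^ 2
          + Real.log 2 / Real.sqrt 2 * (2 * (a * x + b * y) - Real.log 2) := by
  have hl2 : 0 < Real.log 2 := Real.log_pos one_lt_two
  have hG := gapSeries_concave hx hy ha hb hab
  have hxm : x ∈ Ici (0 : ℝ) := by show (0 : ℝ) ≤ x; linarith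
  have hym : y ∈ Ici (0 : ℝ) := by show (0 : ℝ) ≤ y; linarith
  have hE := concaveOn_neg_four_mul_sq_exp_half_sub_one.2 hxm hym ha hb hab
  simp only [smul_eq_mul] at hE
  have hlin : a * (Real.log 2 / Real.sqrt 2 * (2 * x - Real.log 2))
      + b * (Real.log 2 / Real.sqrt 2 * (2 * y - Real.log 2))
      = Real.log 2 / Real.sqrt 2 * (2 * (a * x + b * y) - Real.log 2) := by
    have hb' : b = 1 - a := by linarith
    rw [hb']; ring
  nlinarith [hG, hE, hlin]

end Summit.RiemannHypothesis.RiemannHypothesis.Theorems.DbrWall
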